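import Literature.NumberTheory.EllipticCurves.OpenImageMazurAssemblyProofs
import Literature.NumberTheory.EllipticCurves.QuadraticTwistPadicReduction
import HarnessLib

/-!
# Irreducibility of `E[p]` is invariant under quadratic twists, over any base field (proofs)

Proofs-only file (theorems only — no definitions, no named facts; D-0014) in topic
`Literature/NumberTheory/EllipticCurves`, next to `GaloisAction.lean`
(`WeierstrassCurve.HasIrreducibleModPGaloisRep`), `OpenImageMazurTwistProofs.lean`
(`WeierstrassCurve.exists_addEquiv_geomPoints_quadraticTwist_signed`: the twist isomorphism
`E^{(d)}(F̄) ≃+ E(F̄)`, `Γ_F`-equivariant up to the sign `σ√d/√d`, Silverman *AEC* X.5 Cor. 5.4 /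
X.2 Prop. 2.4) and `OpenImageMazurAssemblyProofs.lean`
(`Mazur1978.hasIrreducibleModPGaloisRep_smul_iff`: invariance under a change of Weierstrass
equation).  It proves, for a Weierstrass equation `W` over ANY field `F` with `2 ≠ 0`:

* `WeierstrassCurve.hasIrreducibleModPGaloisRep_of_addEquiv_signed` — irreducibility of the
  mod-`p` representation is transported along an additive isomorphism of `p`-torsion groups that is
  `Γ_F`-equivariant UP TO SIGN, pointwise (`e (σ • P) = σ • e P ∨ e (σ • P) = -(σ • e P)`): a sign
  does not move a subgroup;
* `WeierstrassCurve.hasIrreducibleModPGaloisRep_iff_of_addEquiv_geomPoints_signed` — the same for a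
  sign-equivariant isomorphism of the full groups of geometric points (restricted to `p`-torsion
  inside the proof), as an `iff`;
* `WeierstrassCurve.hasIrreducibleModPGaloisRep_quadraticTwist_iff` — **`E^{(d)}[p]` is an
  irreducible `Γ_F`-module iff `E[p]` is** (`d ≠ 0`);
* `WeierstrassCurve.hasIrreducibleModPGaloisRep_iff_of_smul_eq_quadraticTwist` — the same for any
  equation `W'` isomorphic over `F` to the twist (`C • W' = W.quadraticTwist d`);
* `WeierstrassCurve.hasIrreducibleModPGaloisRep_baseChange_iff_of_smul_eq_quadraticTwist` — the
  NUMBER-FIELD form asked for by the two-variable main-conjecture cells: for `W, W'` over `ℚ` with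
  `C • W' = W^{(d)}` and any field `K` of characteristic `0` (e.g. an imaginary quadratic field),
  `E'[p]|_{Γ_K}` is irreducible iff `E[p]|_{Γ_K}` is — base change commutes with the twist
  (`WeierstrassCurve.map_quadraticTwist`) and with the change of variables (Mathlib
  `WeierstrassCurve.map_variableChange`), so the statement over `K` is the case `F = K` of the
  previous one.

The `ℚ`-special cases were already in the tree (`Rank1Residual.not_hasIrreducibleModPGaloisRep_twist`
in `Rank1Residual/GVParityTwistProofs.lean`, via rational lines of `E[p]` and `IsElliptic`;
`BurungaleSkinnerTianWan2024.hasIrreducibleModPGaloisRep_of_smul_eq_quadraticTwist`); the present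
file needs neither `IsElliptic` nor `F = ℚ`, and works at the level of `Γ_F`-stable subgroups
directly.  Mathematically: `E^{(d)}[p] ≅ E[p] ⊗ χ_d` as `𝔽_p[Γ_F]`-modules, and twisting by a
character does not change the lattice of stable subspaces (Silverman *AEC* X.5 Cor. 5.4; Serre 1972
§4 for the representation on `E[p]`).

Consumers (cell `bsd-littype`, OPEN-QUESTIONS-01 §K Q35): the twist clauses of
Burungale–Skinner–Tian–Wan Thm. 10.10 (b) replayed from Thm. 10.5 need
`(W.baseChange K).HasIrreducibleModPGaloisRep p` for a model `W` of `E₀^{(d)}` from the same for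
`E₀` (`Thm1010bHypotheses.irrK`); the Yan–Zhu 2026 inputs `cor29_…`, `lemma53_…`, `prop37_…` are
stated with this predicate over `K`.

## References

* [SilvermanAEC2009] J. H. Silverman, *The Arithmetic of Elliptic Curves*, 2nd ed., GTM 106
  (2009), X.2 Prop. 2.4, X.5 Cor. 5.4 (twists), III.§7 (the representation on `E[m]`).
* [Serre1972] J.-P. Serre, *Propriétés galoisiennes des points d'ordre fini des courbes
  elliptiques*, Invent. Math. 15 (1972), §4.
-/

noncomputable section

open scoped Classical

open Field Literature.NumberTheory.EllipticCurves

universe u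

namespace WeierstrassCurve

/-! ### Transport along a sign-equivariant isomorphism of the `p`-torsion -/

/-- **Irreducibility of the mod-`p` representation is transported along an additive isomorphism of
the `p`-torsion that is `Γ_F`-equivariant up to sign** (pointwise: `e (σ • P) = ± σ • e P`).  The
pull-back of a `Γ_F`-stable subgroup of `E'[p]` is `Γ_F`-stable in `E[p]` (a subgroup is closed
under negation), hence `⊥` or `⊤`, and `e` is bijective.  Generalises the tree's equivariant
version `Mazur1978.hasIrreducibleModPGaloisRep_of_addEquiv`.  Deliberate dot-notation extension of
Mathlib's `WeierstrassCurve` namespace (next to `HasIrreducibleModPGaloisRep`).  (Serre 1972 §4: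
the `𝔽_p[Γ_F]`-module `E[p]`; a character twist does not change the stable subspaces.)
[cite: Serre1972, §4 (the Galois module E[p]; stable subgroups under a twist by ±1)] -/
theorem hasIrreducibleModPGaloisRep_of_addEquiv_signed {F : Type u} [Field F]
    {W W' : WeierstrassCurve F} {p : ℕ} (e : geomTorsion W p ≃+ geomTorsion W' p)
    (he : ∀ (σ : absoluteGaloisGroup F) (P : geomTorsion W p),
      e (σ • P) = σ • e P ∨ e (σ • P) = -(σ • e P))
    (h : W.HasIrreducibleModPGaloisRep p) : W'.HasIrreducibleModPGaloisRep p := by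
  intro H' hH'
  have hH : ∀ (σ : absoluteGaloisGroup F), ∀ P ∈ H'.comap e.toAddMonoidHom,
      σ • P ∈ H'.comap e.toAddMonoidHom := by
    intro σ P hP
    rw [AddSubgroup.mem_comap] at hP ⊢
    change e (σ • P) ∈ H'
    rcases he σ P with hσ | hσ
    · rw [hσ]
      exact hH' σ _ hP
    · rw [hσ]
      exact neg_mem (hH' σ _ hP)
  rcases h (H'.comap e.toAddMonoidHom) hH with hbot | htop
  · left
    rw [eq_bot_iff]
    intro Q hQ
    have hQ' : e.symm Q ∈ H'.comap e.toAddMonoidHom := by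
      rw [AddSubgroup.mem_comap]
      change e (e.symm Q) ∈ H'
      rw [e.apply_symm_apply]
      exact hQ
    rw [hbot, AddSubgroup.mem_bot] at hQ'
    rw [AddSubgroup.mem_bot, ← e.apply_symm_apply Q, hQ', map_zero]
  · right
    rw [eq_top_iff]
    intro Q _
    have hQ' : e.symm Q ∈ H'.comap e.toAddMonoidHom := by rw [htop]; exact AddSubgroup.mem_top _
    rw [AddSubgroup.mem_comap] at hQ'
    change e (e.symm Q) ∈ H' at hQ'
    rwa [e.apply_symm_apply] at hQ'

/-- **Irreducibility of `E[p]` is invariant along a sign-equivariant additive isomorphism of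
geometric points.**  If `f : E(F̄) ≃+ E'(F̄)` satisfies `f (σ • P) = ± σ • f P` (pointwise), then
`E[p]` is an irreducible `Γ_F`-module iff `E'[p]` is: `f` restricts to a sign-equivariant
isomorphism `E[p] ≃+ E'[p]` (it commutes with multiplication by `p`), whose inverse is again
sign-equivariant, and `hasIrreducibleModPGaloisRep_of_addEquiv_signed` applies both ways.
Deliberate dot-notation extension of Mathlib's `WeierstrassCurve` namespace.
[cite: Serre1972, §4 (the Galois module E[p]; stable subgroups under a twist by ±1)] -/
theorem hasIrreducibleModPGaloisRep_iff_of_addEquiv_geomPoints_signed {F : Type u} [Field F]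
    {W W' : WeierstrassCurve F} (p : ℕ) (f : geomPoints W ≃+ geomPoints W')
    (hf : ∀ (σ : absoluteGaloisGroup F) (P : geomPoints W),
      f (σ • P) = σ • f P ∨ f (σ • P) = -(σ • f P)) :
    W.HasIrreducibleModPGaloisRep p ↔ W'.HasIrreducibleModPGaloisRep p := by
  -- restriction of `f` to the `p`-torsion
  have htor : ∀ {P : geomPoints W}, P ∈ geomTorsion W p ↔ f P ∈ geomTorsion W' p := by
    intro P
    rw [geomTorsion, geomTorsion, AddSubgroup.torsionBy.nsmul_iff, AddSubgroup.torsionBy.nsmul_iff,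
      ← map_nsmul, AddEquiv.map_eq_zero_iff]
  let e : geomTorsion W p ≃+ geomTorsion W' p :=
    { toFun := fun P ↦ ⟨f P, htor.mp P.2⟩
      invFun := fun Q ↦ ⟨f.symm Q, by rw [htor, f.apply_symm_apply]; exact Q.2⟩
      left_inv := fun P ↦ Subtype.ext (f.symm_apply_apply _)
      right_inv := fun Q ↦ Subtype.ext (f.apply_symm_apply _)
      map_add' := fun P Q ↦ Subtype.ext (by
        change f ((P : geomPoints W) + Q) = f P + f Q
        exact map_add f _ _) }
  have he_coe : ∀ P : geomTorsion W p, ((e P : geomTorsion W' p) : geomPoints W') = f P :=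
    fun _ ↦ rfl
  -- `e` is sign-equivariant
  have he : ∀ (σ : absoluteGaloisGroup F) (P : geomTorsion W p),
      e (σ • P) = σ • e P ∨ e (σ • P) = -(σ • e P) := by
    intro σ P
    rcases hf σ P with hσ | hσ
    · left
      exact Subtype.ext (by
        rw [AddSubgroup.torsionBy.coe_smul, he_coe, he_coe, AddSubgroup.torsionBy.coe_smul, hσ])
    · right
      exact Subtype.ext (by
        rw [AddSubgroup.coe_neg, AddSubgroup.torsionBy.coe_smul, he_coe, he_coe,
          AddSubgroup.torsionBy.coe_smul, hσ])
  -- and so is its inverse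
  have he' : ∀ (σ : absoluteGaloisGroup F) (Q : geomTorsion W' p),
      e.symm (σ • Q) = σ • e.symm Q ∨ e.symm (σ • Q) = -(σ • e.symm Q) := by
    intro σ Q
    rcases he σ (e.symm Q) with hσ | hσ
    · left
      apply e.injective
      rw [e.apply_symm_apply, hσ, e.apply_symm_apply]
    · right
      apply e.injective
      rw [e.apply_symm_apply, map_neg, hσ, e.apply_symm_apply, neg_neg]
  exact ⟨fun h ↦ hasIrreducibleModPGaloisRep_of_addEquiv_signed e he h,
    fun h ↦ hasIrreducibleModPGaloisRep_of_addEquiv_signed e.symm he' h⟩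

/-! ### Quadratic twists -/

/-- **`E^{(d)}[p]` is an irreducible `Γ_F`-module iff `E[p]` is** (`d ≠ 0`, `2 ≠ 0` in `F`).  The
twist isomorphism `E^{(d)}(F̄) ≃+ E(F̄)` is `Γ_F`-equivariant up to the sign `σ√d/√d`
(`exists_addEquiv_geomPoints_quadraticTwist_signed`, Silverman *AEC* X.5 Cor. 5.4 / X.2 Prop. 2.4),
and a sign does not move `Γ_F`-stable subgroups
(`hasIrreducibleModPGaloisRep_iff_of_addEquiv_geomPoints_signed`).  Equivalently:
`E^{(d)}[p] ≅ E[p] ⊗ χ_d`.  Deliberate dot-notation extension of Mathlib's `WeierstrassCurve`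
namespace. [cite: SilvermanAEC2009, X.5 Cor. 5.4] -/
theorem hasIrreducibleModPGaloisRep_quadraticTwist_iff {F : Type u} [Field F] [NeZero (2 : F)]
    (W : WeierstrassCurve F) {d : F} (hd : d ≠ 0) (p : ℕ) :
    (W.quadraticTwist d).HasIrreducibleModPGaloisRep p ↔ W.HasIrreducibleModPGaloisRep p := by
  obtain ⟨f, hf⟩ := W.exists_addEquiv_geomPoints_quadraticTwist_signed hd
  refine hasIrreducibleModPGaloisRep_iff_of_addEquiv_geomPoints_signed p f fun σ P ↦ ?_
  rcases hf σ with hσ | hσ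
  · exact Or.inl (hσ P)
  · exact Or.inr (hσ P)

/-- **Irreducibility of `E[p]` for an equation isomorphic to a quadratic twist.**  If
`C • W' = W^{(d)}` over `F` (`d ≠ 0`, `2 ≠ 0` in `F`), then `E'[p]` is an irreducible
`Γ_F`-module iff `E[p]` is: invariance under the change of equation
(`Mazur1978.hasIrreducibleModPGaloisRep_smul_iff`) and under the twist
(`hasIrreducibleModPGaloisRep_quadraticTwist_iff`).  The `ℚ`-case with `IsElliptic` was the tree's
`BurungaleSkinnerTianWan2024.hasIrreducibleModPGaloisRep_of_smul_eq_quadraticTwist` /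
`Rank1Residual.not_hasIrreducibleModPGaloisRep_twist`.  Deliberate dot-notation extension of
Mathlib's `WeierstrassCurve` namespace. [cite: SilvermanAEC2009, X.5 Cor. 5.4] -/
theorem hasIrreducibleModPGaloisRep_iff_of_smul_eq_quadraticTwist {F : Type u} [Field F]
    [NeZero (2 : F)] (W W' : WeierstrassCurve F) {d : F} (hd : d ≠ 0) {C : VariableChange F}
    (hC : C • W' = W.quadraticTwist d) (p : ℕ) :
    W'.HasIrreducibleModPGaloisRep p ↔ W.HasIrreducibleModPGaloisRep p := by
  rw [← Mazur1978.hasIrreducibleModPGaloisRep_smul_iff W' C p, hC]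
  exact W.hasIrreducibleModPGaloisRep_quadraticTwist_iff hd p

/-! ### Over a number field: base change of a twist defined over `ℚ` -/

/-- **Base change commutes with the quadratic twist** (restatement of the tree's
`WeierstrassCurve.map_quadraticTwist` in `baseChange` form): `(W^{(d)})_K = (W_K)^{(d)}` with `d`
viewed in `K` (the twist is given by universal formulas in the `bᵢ`, Silverman *AEC* X.5 / the
tree's `QuadraticTwist.lean`). [cite: SilvermanAEC2009, X.5 Cor. 5.4 (the twist E^{(d)} by universal formulas)] -/
theorem baseChange_quadraticTwist {F : Type*} [Field F] (W : WeierstrassCurve F) (K : Type*)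
    [Field K] [Algebra F K] (d : F) :
    (W.quadraticTwist d).baseChange K = (W.baseChange K).quadraticTwist (algebraMap F K d) := by
  rw [baseChange, baseChange, map_quadraticTwist]

/-- **(irr_K) is invariant under quadratic twists defined over `ℚ`.**  Let `W, W'` be Weierstrass
equations over `ℚ` with `C • W' = W^{(d)}` (`d ≠ 0`) and let `K` be a field of characteristic `0`
(e.g. an imaginary quadratic field).  Then `E'[p]` is an irreducible `Γ_K`-module iff `E[p]` is:
over `K` one still has `C_K • W'_K = (W_K)^{(d)}` (Mathlib `WeierstrassCurve.map_variableChange`,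
tree `map_quadraticTwist`), so this is `hasIrreducibleModPGaloisRep_iff_of_smul_eq_quadraticTwist`
over `F = K`.  This is the "K-rational twist-invariance of (irr_L)" that the replay of the twist
clauses of Burungale–Skinner–Tian–Wan Thm. 10.10 (b) from Thm. 10.5 consumes (cell `bsd-littype`,
OPEN-QUESTIONS-01 §K Q35), in the currency of `Thm1010bHypotheses.irrK` and of the Yan–Zhu 2026
inputs `cor29_…` / `lemma53_…` / `prop37_…`.  Deliberate dot-notation extension of Mathlib's
`WeierstrassCurve` namespace. [cite: SilvermanAEC2009, X.5 Cor. 5.4] -/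
theorem hasIrreducibleModPGaloisRep_baseChange_iff_of_smul_eq_quadraticTwist
    (W W' : WeierstrassCurve ℚ) {d : ℚ} (hd : d ≠ 0) {C : VariableChange ℚ}
    (hC : C • W' = W.quadraticTwist d) (K : Type u) [Field K] [CharZero K] (p : ℕ) :
    (W'.baseChange K).HasIrreducibleModPGaloisRep p ↔
      (W.baseChange K).HasIrreducibleModPGaloisRep p := by
  haveI : NeZero (2 : K) := ⟨two_ne_zero⟩
  have hdK : algebraMap ℚ K d ≠ 0 := by
    rw [ne_eq, map_eq_zero_iff _ (algebraMap ℚ K).injective]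
    exact hd
  have hCK : (C.map (algebraMap ℚ K)) • (W'.baseChange K) =
      (W.baseChange K).quadraticTwist (algebraMap ℚ K d) := by
    rw [← baseChange_quadraticTwist, ← hC, baseChange, baseChange, map_variableChange]
  exact hasIrreducibleModPGaloisRep_iff_of_smul_eq_quadraticTwist (W.baseChange K)
    (W'.baseChange K) hdK hCK p

/-- **Reducibility over `K` is likewise invariant** (the contrapositive packaging, for consumers
that carry `¬ HasIrreducibleModPGaloisRep`, e.g. the Eisenstein cells): with `C • W' = W^{(d)}`
over `ℚ`, `E'[p]|_{Γ_K}` is reducible iff `E[p]|_{Γ_K}` is. [cite: SilvermanAEC2009, X.5 Cor. 5.4] -/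
theorem not_hasIrreducibleModPGaloisRep_baseChange_iff_of_smul_eq_quadraticTwist
    (W W' : WeierstrassCurve ℚ) {d : ℚ} (hd : d ≠ 0) {C : VariableChange ℚ}
    (hC : C • W' = W.quadraticTwist d) (K : Type u) [Field K] [CharZero K] (p : ℕ) :
    ¬ (W'.baseChange K).HasIrreducibleModPGaloisRep p ↔
      ¬ (W.baseChange K).HasIrreducibleModPGaloisRep p :=
  (hasIrreducibleModPGaloisRep_baseChange_iff_of_smul_eq_quadraticTwist W W' hd hC K p).not

end WeierstrassCurve

end
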